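import Summits.CriticalPhenomena.CardyFormulaZ2.Theorems.CardyUSTContinuationKirchhoffExtremalLengthG02Dual2
import Literature.Probability.LatticeModels.SquareTilingUniformization

/-!
# Non-edge sides: flux-free steps, the missing side of the outer square of an exit, and which
# lattice sides pass near a point of a side (G02 discretisation)

Support file for `KirchhoffExtremalLength` (route CardyUSTContinuation of `CardyFormulaZ2`, item
stmt-CriticalPhenomena-11234), towards the upper half of `G02ModulusConvergence` (`…Defs.lean`).
For `Ω_δ = discreteDomainGraph Ω δ` (closed mesh edges in `Ω̄`) the flux-free connections between
exits of the face component near a boundary point cannot follow the boundary curve (which may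
pass through mesh edges); they are built instead (`…G02Dual6.lean`) from exterior paths and two
short end segments. The elementary inputs:

* a step of a walk of squares across a side that is NOT an edge of `Ω_δ` carries no current
  (`stepFlux_eq_zero_of_not_adj_sep`, `walkFlux_eq_zero_of_not_adj_sep`), e.g. a side containing
  an exterior point (`not_adj_of_mem_segment_of_not_mem_closure`);
* **the outer square of an exit has a missing side with an end in `Ω_δ`**
  (`exists_missing_side`), on which `∂Ω` has a point (`…G02MissingEdge`);
* **sides near a point of a side** (`side_near_point_of_side`): a lattice side passing within
  `η ≤ δ/2` of a point `z` of the side `[δa, δ(a + eᵢ)]` is that side, or has the end `δa`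
  (then `dist z δa < η`) or the end `δ(a+eᵢ)` (then `dist z δ(a+eᵢ) < η`) as an end point.
-/

noncomputable section

namespace Summit.CriticalPhenomena.CardyFormulaZ2.Theorems

namespace KirchhoffSlope

open Set Metric Filter Topology SimpleGraph
open Literature.Probability Literature.Probability.LatticeModels Literature.Probability.Percolation
open Literature.Probability.LatticeModels.SquareTiling (stepFlux walkFlux walkFlux_cons closedSq
  convex_closedSq meshPoint_mem_closedSq side_subset_closedSq re_mem_uIcc_of_mem_segment
  im_mem_uIcc_of_mem_segment)
open Literature.Probability.RandomPlanarGeometry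

variable {Ω : Set ℂ} {δ : ℝ}

/-! ### Steps across non-edges carry no current -/

/-- A step of a walk of squares whose crossed side (the lattice edge `{sepLo, sepHi}`) is not an
edge of `Ω_δ` carries no current. [folklore] -/
theorem stepFlux_eq_zero_of_not_adj_sep (h : Site 2 → ℝ) {x y : Site 2} (hxy : (zdGraph 2).Adj x y)
    (hn : ¬ (discreteDomainGraph Ω δ).Adj (sepLo x y) (sepHi x y)) :
    stepFlux (ecurH Ω δ h) (ecurV Ω δ h) x y = 0 := by
  have key : ecur Ω δ h (sepLo x y) (sepHi x y) = 0 := ecur_of_not_adj hn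
  rcases stepKind_of_adj hxy with ⟨h0, h1⟩ | ⟨h0, h1⟩ | ⟨h1, h0⟩ | ⟨h1, h0⟩
  · have hy : y = x + Pi.single 0 1 := by simp [Site.eq_iff_two, h0, h1]
    subst hy
    rw [sepLo_add_e0, sepHi_add_e0] at key
    have hval : stepFlux (ecurH Ω δ h) (ecurV Ω δ h) x (x + Pi.single 0 1) = -ecurV Ω δ h (x - Pi.single 1 1) := by
      unfold stepFlux
      have c0 : (x + Pi.single 0 1 : Site 2) 0 = x 0 + 1 := by simp
      have c1 : (x + Pi.single 0 1 : Site 2) 1 = x 1 := by simp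
      simp [c0, c1]
    have e1 : x - Pi.single 1 1 + 1 = x + Pi.single 0 1 := by ext i; fin_cases i <;> simp
    rw [hval, ecurV, e1, key, neg_zero]
  · have hx : x = y + Pi.single 0 1 := by simp [Site.eq_iff_two, h0, h1]
    subst hx
    rw [sepLo_comm, sepHi_comm, sepLo_add_e0, sepHi_add_e0] at key
    have hval : stepFlux (ecurH Ω δ h) (ecurV Ω δ h) (y + Pi.single 0 1) y = ecurV Ω δ h (y - Pi.single 1 1) := by
      unfold stepFlux
      have c0 : (y + Pi.single 0 1 : Site 2) 0 = y 0 + 1 := by simp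
      have c1 : (y + Pi.single 0 1 : Site 2) 1 = y 1 := by simp
      simp [c0, c1]
      omega
    have e1 : y - Pi.single 1 1 + 1 = y + Pi.single 0 1 := by ext i; fin_cases i <;> simp
    rw [hval, ecurV, e1, key]
  · have hy : y = x + Pi.single 1 1 := by simp [Site.eq_iff_two, h0, h1]
    subst hy
    rw [sepLo_add_e1, sepHi_add_e1] at key
    have hval : stepFlux (ecurH Ω δ h) (ecurV Ω δ h) x (x + Pi.single 1 1) = ecurH Ω δ h (x - Pi.single 0 1) := by
      unfold stepFlux
      have c0 : (x + Pi.single 1 1 : Site 2) 0 = x 0 := by simp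
      have c1 : (x + Pi.single 1 1 : Site 2) 1 = x 1 + 1 := by simp
      simp [c0, c1]
    have e1 : x - Pi.single 0 1 + 1 = x + Pi.single 1 1 := by ext i; fin_cases i <;> simp
    rw [hval, ecurH, e1, key]
  · have hx : x = y + Pi.single 1 1 := by simp [Site.eq_iff_two, h0, h1]
    subst hx
    rw [sepLo_comm, sepHi_comm, sepLo_add_e1, sepHi_add_e1] at key
    have hval : stepFlux (ecurH Ω δ h) (ecurV Ω δ h) (y + Pi.single 1 1) y = -ecurH Ω δ h (y - Pi.single 0 1) := by
      unfold stepFlux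
      have c0 : (y + Pi.single 1 1 : Site 2) 0 = y 0 := by simp
      have c1 : (y + Pi.single 1 1 : Site 2) 1 = y 1 + 1 := by simp
      simp [c0, c1]
      omega
    have e1 : y - Pi.single 0 1 + 1 = y + Pi.single 1 1 := by ext i; fin_cases i <;> simp
    rw [hval, ecurH, e1, key, neg_zero]

/-- A walk of squares crossing only non-edges of `Ω_δ` carries no flux. [folklore] -/
theorem walkFlux_eq_zero_of_not_adj_sep (h : Site 2 → ℝ) {a b : Site 2} (ω : (zdGraph 2).Walk a b)
    (hω : ∀ d ∈ ω.darts, ¬ (discreteDomainGraph Ω δ).Adj (sepLo d.fst d.snd) (sepHi d.fst d.snd)) :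
    walkFlux (ecurH Ω δ h) (ecurV Ω δ h) ω = 0 := by
  induction ω with
  | nil => rfl
  | cons hxy p ih =>
    rw [walkFlux_cons, ih fun d hd => hω d (by simp [hd]), add_zero]
    exact stepFlux_eq_zero_of_not_adj_sep h hxy (hω ⟨(_, _), hxy⟩ (by simp))

/-- A lattice edge whose closed segment contains a point outside `Ω̄` (an exterior point) is not
an edge of `Ω_δ`. [folklore] -/
theorem not_adj_of_mem_segment_of_not_mem_closure {u v : Site 2} {w : ℂ} (hw : w ∈ segment ℝ (meshPoint δ u) (meshPoint δ v)) (hwΩ : w ∉ closure Ω) :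
    ¬ (discreteDomainGraph Ω δ).Adj u v := fun hadj =>
  hwΩ ((meshGraph_adj_iff.1 (discreteDomainGraph_adj_iff.1 hadj).1).2 hw)

/-- A lattice edge one of whose end points is not a mesh vertex (e.g. its mesh point lies on
`∂Ω`) is not an edge of `Ω_δ`. [folklore] -/
theorem not_adj_of_not_mem_meshVertices {u v : Site 2} (h : u ∉ meshVertices Ω δ ∨ v ∉ meshVertices Ω δ) :
    ¬ (discreteDomainGraph Ω δ).Adj u v := fun hadj => by
  obtain ⟨-, hu, hv⟩ := discreteDomainGraph_adj_iff.1 hadj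
  exact h.elim (fun h => h (meshDomain_subset_meshVertices _ _ hu)) (fun h => h (meshDomain_subset_meshVertices _ _ hv))

/-! ### The missing side of the outer square of an exit -/
/-- If `p` is an inner face and `p'` a lattice neighbour, some corner of the square `p'` is a
vertex of `Ω_δ` (an end of the common side). [folklore] -/
theorem exists_corner_mem_meshDomain_of_adj {p p' : Site 2} (hp : IsInnerFace Ω δ p) (hpp' : (zdGraph 2).Adj p p') :
    p' ∈ meshDomain Ω δ ∨ p' + Pi.single 0 1 ∈ meshDomain Ω δ ∨ p' + Pi.single 1 1 ∈ meshDomain Ω δ ∨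
      p' + Pi.single 0 1 + Pi.single 1 1 ∈ meshDomain Ω δ := by
  obtain ⟨aB, aT, aL, aR⟩ := hp
  rcases stepKind_of_adj hpp' with ⟨h0, h1⟩ | ⟨h0, h1⟩ | ⟨h1, h0⟩ | ⟨h1, h0⟩
  · -- `p'` to the right of `p`: the corner `p'` of `p'` is `p + e₀`
    left
    convert (discreteDomainGraph_adj_iff.1 aB).2.2 using 1
    ext i; fin_cases i <;> simp <;> omega
  · -- `p'` to the left: the corner `p' + e₀ = p`
    right; left
    convert (discreteDomainGraph_adj_iff.1 aB).2.1 using 1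
    ext i; fin_cases i <;> simp <;> omega
  · -- `p'` above: the corner `p' = p + e₁`
    left
    convert (discreteDomainGraph_adj_iff.1 aL).2.2 using 1
    ext i; fin_cases i <;> simp <;> omega
  · -- `p'` below: the corner `p' + e₁ = p`
    right; right; left
    convert (discreteDomainGraph_adj_iff.1 aL).2.1 using 1
    ext i; fin_cases i <;> simp <;> omega

/-- **A non-inner square with a corner in `Ω_δ` has a missing side with an end in `Ω_δ`.** The
side is returned in normal form `[u, u + eᵢ]`, together with its position in the closed square.
(If some side is an edge of `Ω_δ` its ends are vertices of `Ω_δ`, and a missing side next to it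
qualifies; if all sides are missing, a side at the given corner qualifies.) [folklore] -/
theorem exists_missing_side (hδ : 0 ≤ δ) {p : Site 2} (hp : ¬ IsInnerFace Ω δ p)
    (hc : p ∈ meshDomain Ω δ ∨ p + Pi.single 0 1 ∈ meshDomain Ω δ ∨ p + Pi.single 1 1 ∈ meshDomain Ω δ ∨
      p + Pi.single 0 1 + Pi.single 1 1 ∈ meshDomain Ω δ) :
    ∃ (u : Site 2) (i : Fin 2), ¬ (discreteDomainGraph Ω δ).Adj u (u + Pi.single i 1) ∧
      (u ∈ meshDomain Ω δ ∨ u + Pi.single i 1 ∈ meshDomain Ω δ) ∧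
      segment ℝ (meshPoint δ u) (meshPoint δ (u + Pi.single i 1)) ⊆ closedSq δ p := by
  -- the four sides in normal form: bottom `(p, 0)`, left `(p, 1)`, top `(p + e₁, 0)`, right `(p + e₀, 1)`
  have e : p + Pi.single 1 1 + Pi.single 0 1 = p + Pi.single 0 1 + Pi.single 1 1 := by abel
  have sB : segment ℝ (meshPoint δ p) (meshPoint δ (p + Pi.single 0 1)) ⊆ closedSq δ p :=
    side_subset_closedSq hδ ⟨Or.inl rfl, Or.inl rfl⟩ ⟨Or.inr (by simp), Or.inl (by simp)⟩
  have sL : segment ℝ (meshPoint δ p) (meshPoint δ (p + Pi.single 1 1)) ⊆ closedSq δ p :=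
    side_subset_closedSq hδ ⟨Or.inl rfl, Or.inl rfl⟩ ⟨Or.inl (by simp), Or.inr (by simp)⟩
  have sT : segment ℝ (meshPoint δ (p + Pi.single 1 1)) (meshPoint δ (p + Pi.single 1 1 + Pi.single 0 1)) ⊆ closedSq δ p :=
    side_subset_closedSq hδ ⟨Or.inl (by simp), Or.inr (by simp)⟩ ⟨Or.inr (by simp), Or.inr (by simp)⟩
  have sR : segment ℝ (meshPoint δ (p + Pi.single 0 1)) (meshPoint δ (p + Pi.single 0 1 + Pi.single 1 1)) ⊆ closedSq δ p :=
    side_subset_closedSq hδ ⟨Or.inr (by simp), Or.inl (by simp)⟩ ⟨Or.inr (by simp), Or.inr (by simp)⟩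
  -- packaging the four possible answers
  have useB : ¬ (discreteDomainGraph Ω δ).Adj p (p + Pi.single 0 1) → (p ∈ meshDomain Ω δ ∨ p + Pi.single 0 1 ∈ meshDomain Ω δ) → _ :=
    fun hn hm => (⟨p, 0, hn, hm, sB⟩ : ∃ (u : Site 2) (i : Fin 2), ¬ (discreteDomainGraph Ω δ).Adj u (u + Pi.single i 1) ∧
      (u ∈ meshDomain Ω δ ∨ u + Pi.single i 1 ∈ meshDomain Ω δ) ∧
      segment ℝ (meshPoint δ u) (meshPoint δ (u + Pi.single i 1)) ⊆ closedSq δ p)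
  have useL : ¬ (discreteDomainGraph Ω δ).Adj p (p + Pi.single 1 1) → (p ∈ meshDomain Ω δ ∨ p + Pi.single 1 1 ∈ meshDomain Ω δ) → _ :=
    fun hn hm => (⟨p, 1, hn, hm, sL⟩ : ∃ (u : Site 2) (i : Fin 2), ¬ (discreteDomainGraph Ω δ).Adj u (u + Pi.single i 1) ∧
      (u ∈ meshDomain Ω δ ∨ u + Pi.single i 1 ∈ meshDomain Ω δ) ∧
      segment ℝ (meshPoint δ u) (meshPoint δ (u + Pi.single i 1)) ⊆ closedSq δ p)
  have useT : ¬ (discreteDomainGraph Ω δ).Adj (p + Pi.single 1 1) (p + Pi.single 1 1 + Pi.single 0 1) →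
      (p + Pi.single 1 1 ∈ meshDomain Ω δ ∨ p + Pi.single 1 1 + Pi.single 0 1 ∈ meshDomain Ω δ) → _ :=
    fun hn hm => (⟨p + Pi.single 1 1, 0, hn, hm, sT⟩ : ∃ (u : Site 2) (i : Fin 2), ¬ (discreteDomainGraph Ω δ).Adj u (u + Pi.single i 1) ∧
      (u ∈ meshDomain Ω δ ∨ u + Pi.single i 1 ∈ meshDomain Ω δ) ∧
      segment ℝ (meshPoint δ u) (meshPoint δ (u + Pi.single i 1)) ⊆ closedSq δ p)
  have useR : ¬ (discreteDomainGraph Ω δ).Adj (p + Pi.single 0 1) (p + Pi.single 0 1 + Pi.single 1 1) →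
      (p + Pi.single 0 1 ∈ meshDomain Ω δ ∨ p + Pi.single 0 1 + Pi.single 1 1 ∈ meshDomain Ω δ) → _ :=
    fun hn hm => (⟨p + Pi.single 0 1, 1, hn, hm, sR⟩ : ∃ (u : Site 2) (i : Fin 2), ¬ (discreteDomainGraph Ω δ).Adj u (u + Pi.single i 1) ∧
      (u ∈ meshDomain Ω δ ∨ u + Pi.single i 1 ∈ meshDomain Ω δ) ∧
      segment ℝ (meshPoint δ u) (meshPoint δ (u + Pi.single i 1)) ⊆ closedSq δ p)
  -- ends of edges are vertices of `Ω_δ`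
  have ends : ∀ {x y : Site 2}, (discreteDomainGraph Ω δ).Adj x y → x ∈ meshDomain Ω δ ∧ y ∈ meshDomain Ω δ :=
    fun h => (discreteDomainGraph_adj_iff.1 h).2
  by_cases aB : (discreteDomainGraph Ω δ).Adj p (p + Pi.single 0 1)
  · -- bottom is an edge: `p`, `p + e₀` are vertices
    by_cases aL : (discreteDomainGraph Ω δ).Adj p (p + Pi.single 1 1)
    · by_cases aR : (discreteDomainGraph Ω δ).Adj (p + Pi.single 0 1) (p + Pi.single 0 1 + Pi.single 1 1)
      · -- top must be missing
        refine useT (fun aT => hp ⟨aB, aT, aL, aR⟩) (Or.inl (ends aL).2)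
      · exact useR aR (Or.inl (ends aB).2)
    · exact useL aL (Or.inl (ends aB).1)
  · by_cases aL : (discreteDomainGraph Ω δ).Adj p (p + Pi.single 1 1)
    · exact useB aB (Or.inl (ends aL).1)
    · by_cases aT : (discreteDomainGraph Ω δ).Adj (p + Pi.single 1 1) (p + Pi.single 1 1 + Pi.single 0 1)
      · exact useL aL (Or.inr (ends aT).1)
      · by_cases aR : (discreteDomainGraph Ω δ).Adj (p + Pi.single 0 1) (p + Pi.single 0 1 + Pi.single 1 1)
        · exact useB aB (Or.inr (ends aR).1)
        · -- all four sides missing: use the given corner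
          rcases hc with h | h | h | h
          · exact useB aB (Or.inl h)
          · exact useB aB (Or.inr h)
          · exact useL aL (Or.inr h)
          · exact useR aR (Or.inr h)

/-! ### Lattice sides near a point of a side -/
/-- Coordinates of a point of the side `[δa, δ(a + eᵢ)]`. [folklore] -/
theorem coords_of_mem_side (hδ : 0 < δ) {a : Site 2} {i : Fin 2} {z : ℂ} (hz : z ∈ segment ℝ (meshPoint δ a) (meshPoint δ (a + Pi.single i 1))) :
    (i = 0 → z.im = δ * a 1 ∧ δ * a 0 ≤ z.re ∧ z.re ≤ δ * (a 0 + 1)) ∧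
    (i = 1 → z.re = δ * a 0 ∧ δ * a 1 ≤ z.im ∧ z.im ≤ δ * (a 1 + 1)) := by
  have hre := re_mem_uIcc_of_mem_segment hz
  have him := im_mem_uIcc_of_mem_segment hz
  rw [meshPoint_re, meshPoint_re] at hre
  rw [meshPoint_im, meshPoint_im] at him
  constructor
  · rintro rfl
    have e0 : (((a + Pi.single 0 1 : Site 2) 0 : ℤ) : ℝ) = a 0 + 1 := by simp
    have e1 : (((a + Pi.single 0 1 : Site 2) 1 : ℤ) : ℝ) = a 1 := by simp
    rw [e0] at hre; rw [e1] at him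
    rw [min_self, max_self] at him
    rw [min_eq_left (by nlinarith), max_eq_right (by nlinarith)] at hre
    exact ⟨le_antisymm him.2 him.1, hre.1, hre.2⟩
  · rintro rfl
    have e0 : (((a + Pi.single 1 1 : Site 2) 0 : ℤ) : ℝ) = a 0 := by simp
    have e1 : (((a + Pi.single 1 1 : Site 2) 1 : ℤ) : ℝ) = a 1 + 1 := by simp
    rw [e0] at hre; rw [e1] at him
    rw [min_self, max_self] at hre
    rw [min_eq_left (by nlinarith), max_eq_right (by nlinarith)] at him
    exact ⟨le_antisymm hre.2 hre.1, him.1, him.2⟩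

/-- Integers whose `δ`-multiples are less than `δ` apart are equal. [folklore] -/
theorem int_eq_of_abs_mul_sub_lt (hδ : 0 < δ) {m n : ℤ} (h : |δ * m - δ * n| < δ) : m = n := by
  rw [← mul_sub, abs_mul, abs_of_pos hδ] at h
  have h1 : |((m : ℝ)) - n| < 1 := by nlinarith [abs_nonneg (((m : ℝ)) - n)]
  have h2 : |m - n| < 1 := by
    have : |((m - n : ℤ) : ℝ)| < 1 := by push_cast; exact h1
    rw [← Int.cast_abs] at this; exact_mod_cast this
  rw [abs_lt] at h2; omega

/-- Integers `m` with `δ n - δ < δ m < δ n + 2δ`... : if `δ n - δ < δ m` and `δ m < δ (n + 2)` then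
`m ∈ {n, n+1}`. [folklore] -/
theorem int_mem_pair_of_bounds (hδ : 0 < δ) {m n : ℤ} (h1 : δ * n - δ < δ * m) (h2 : δ * m < δ * (n + 2)) : m = n ∨ m = n + 1 := by
  have k1 : ((n : ℝ)) - 1 < m := by nlinarith
  have k2 : ((m : ℝ)) < n + 2 := by nlinarith
  have k1' : n - 1 < m := by exact_mod_cast k1
  have k2' : m < n + 2 := by exact_mod_cast k2
  omega

/-- **Lattice sides near a point of a side.** Let `z` be a point of the side `[δa, δ(a + eᵢ)]` and
`w` a point of the side `[δc, δ(c + eⱼ)]` with `dist z w < η`, `2η ≤ δ`. Then the two sides are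
equal, or `δa` is an end of the second side and `dist z (δa) < η`, or `δ(a + eᵢ)` is an end of the
second side and `dist z (δ(a+eᵢ)) < η`. [folklore] -/
theorem side_near_point_of_side (hδ : 0 < δ) {η : ℝ} (hη2 : 2 * η ≤ δ) {a c : Site 2} {i j : Fin 2}
    {z w : ℂ} (hz : z ∈ segment ℝ (meshPoint δ a) (meshPoint δ (a + Pi.single i 1)))
    (hw : w ∈ segment ℝ (meshPoint δ c) (meshPoint δ (c + Pi.single j 1))) (hzw : dist z w < η) :
    (c = a ∧ j = i) ∨
    (dist z (meshPoint δ a) < η ∧ (c = a ∨ c + Pi.single j 1 = a)) ∨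
    (dist z (meshPoint δ (a + Pi.single i 1)) < η ∧ (c = a + Pi.single i 1 ∨ c + Pi.single j 1 = a + Pi.single i 1)) := by
  have hη : 0 < η := lt_of_le_of_lt dist_nonneg hzw
  have hre : |z.re - w.re| < η := (Complex.abs_re_le_norm (z - w)).trans_lt (by rwa [← Complex.dist_eq])
  have him : |z.im - w.im| < η := (Complex.abs_im_le_norm (z - w)).trans_lt (by rwa [← Complex.dist_eq])
  rw [abs_lt] at hre him
  obtain ⟨hz0, hz1⟩ := coords_of_mem_side hδ hz
  obtain ⟨hw0, hw1⟩ := coords_of_mem_side hδ hw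
  have ha : meshPoint δ a = ⟨δ * a 0, δ * a 1⟩ := Complex.ext (by simp) (by simp)
  have hai : meshPoint δ (a + Pi.single i 1) =
      ⟨δ * (a + Pi.single i 1 : Site 2) 0, δ * (a + Pi.single i 1 : Site 2) 1⟩ := Complex.ext (by simp) (by simp)
  have hηδ : η < δ := by linarith
  obtain rfl | rfl : i = 0 ∨ i = 1 := by fin_cases i <;> simp
  all_goals obtain rfl | rfl : j = 0 ∨ j = 1 := by fin_cases j <;> simp
  · -- both horizontal
    obtain ⟨zi, zr, zr'⟩ := hz0 rfl
    obtain ⟨wi, wr, wr'⟩ := hw0 rfl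
    have hc1 : c 1 = a 1 := int_eq_of_abs_mul_sub_lt hδ (by rw [← wi, ← zi, abs_sub_comm]; exact (abs_lt.2 him).trans hηδ)
    have hc0 : c 0 = a 0 - 1 ∨ c 0 = a 0 - 1 + 1 ∨ c 0 = a 0 + 1 := by
      have k1 : δ * ((a 0 - 1 : ℤ) : ℝ) - δ < δ * c 0 := by push_cast; nlinarith
      have k2 : δ * (c 0 : ℝ) < δ * (((a 0 - 1 : ℤ) : ℝ) + 2) + δ := by push_cast; nlinarith
      by_cases hlt : δ * (c 0 : ℝ) < δ * (((a 0 - 1 : ℤ) : ℝ) + 2)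
      · rcases int_mem_pair_of_bounds hδ k1 hlt with h | h
        · exact Or.inl h
        · exact Or.inr (Or.inl h)
      · right; right
        push Not at hlt
        have k3 : δ * (c 0 : ℝ) < δ * ((a 0 + 1 : ℤ) + 2 : ℝ) := by push_cast at hlt ⊢; nlinarith
        have k4 : δ * ((a 0 + 1 : ℤ) : ℝ) - δ < δ * c 0 := by push_cast at hlt ⊢; nlinarith
        rcases int_mem_pair_of_bounds hδ k4 k3 with h | h
        · exact h
        · exfalso
          have : δ * (c 0 : ℝ) = δ * (a 0 + 2) := by rw [h]; push_cast; ring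
          nlinarith
    rcases hc0 with h | h | h
    · -- `c = a - e₀`: `c + e₀ = a`, and `z` is within `η` of `δa`
      right; left
      refine ⟨?_, Or.inr ?_⟩
      · rw [ha, Complex.dist_of_im_eq (by simpa using zi), Real.dist_eq, abs_lt]
        simp only
        have : δ * (c 0 : ℝ) = δ * a 0 - δ := by rw [h]; push_cast; ring
        constructor <;> nlinarith
      · ext k; fin_cases k <;> simp [h, hc1]
    · left
      refine ⟨?_, rfl⟩
      ext k; fin_cases k <;> simp [hc1]; omega
    · -- `c = a + e₀`, and `z` is within `η` of `δ(a + e₀)`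
      right; right
      refine ⟨?_, Or.inl ?_⟩
      · rw [hai, Complex.dist_of_im_eq (by simpa using zi), Real.dist_eq, abs_lt]
        simp only [Fin.isValue, Pi.add_apply, Pi.single_eq_same, Int.cast_add, Int.cast_one]
        have : δ * (c 0 : ℝ) = δ * a 0 + δ := by rw [h]; push_cast; ring
        constructor <;> nlinarith
      · ext k; fin_cases k <;> simp [h, hc1]
  · -- `z` on a horizontal side, `w` on a vertical side
    obtain ⟨zi, zr, zr'⟩ := hz0 rfl
    obtain ⟨wr, wi, wi'⟩ := hw1 rfl
    have hc1 : c 1 = a 1 - 1 ∨ c 1 = a 1 - 1 + 1 := by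
      refine int_mem_pair_of_bounds hδ ?_ ?_ <;> push_cast <;> nlinarith
    have hc0 : c 0 = a 0 ∨ c 0 = a 0 + 1 := by
      refine int_mem_pair_of_bounds hδ ?_ ?_ <;> nlinarith
    have hcA : ∀ {x : Site 2}, x 0 = c 0 → x 1 = a 1 → (c = x ∨ c + Pi.single 1 1 = x) := by
      intro x hx0 hx1
      rcases hc1 with h | h
      · right; ext k; fin_cases k <;> simp [hx0, hx1, h]
      · left; ext k; fin_cases k <;> simp [hx0, hx1, h]
    rcases hc0 with h | h
    · right; left
      refine ⟨?_, hcA (by simp [h]) (by simp)⟩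
      rw [ha, Complex.dist_of_im_eq (by simpa using zi), Real.dist_eq, abs_lt]
      simp only
      have : δ * (c 0 : ℝ) = δ * a 0 := by rw [h]
      constructor <;> nlinarith
    · right; right
      refine ⟨?_, hcA (by simp [h]) (by simp)⟩
      rw [hai, Complex.dist_of_im_eq (by simpa using zi), Real.dist_eq, abs_lt]
      simp only [Fin.isValue, Pi.add_apply, Pi.single_eq_same, Int.cast_add, Int.cast_one]
      have : δ * (c 0 : ℝ) = δ * a 0 + δ := by rw [h]; push_cast; ring
      constructor <;> nlinarith
  · -- `z` on a vertical side, `w` on a horizontal side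
    obtain ⟨zr, zi, zi'⟩ := hz1 rfl
    obtain ⟨wi, wr, wr'⟩ := hw0 rfl
    have hc0 : c 0 = a 0 - 1 ∨ c 0 = a 0 - 1 + 1 := by
      refine int_mem_pair_of_bounds hδ ?_ ?_ <;> push_cast <;> nlinarith
    have hc1 : c 1 = a 1 ∨ c 1 = a 1 + 1 := by
      refine int_mem_pair_of_bounds hδ ?_ ?_ <;> nlinarith
    have hcA : ∀ {x : Site 2}, x 1 = c 1 → x 0 = a 0 → (c = x ∨ c + Pi.single 0 1 = x) := by
      intro x hx1 hx0
      rcases hc0 with h | h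
      · right; ext k; fin_cases k <;> simp [hx0, hx1, h]
      · left; ext k; fin_cases k <;> simp [hx0, hx1, h]
    rcases hc1 with h | h
    · right; left
      refine ⟨?_, hcA (by simp [h]) (by simp)⟩
      rw [ha, Complex.dist_of_re_eq (by simpa using zr), Real.dist_eq, abs_lt]
      simp only
      have : δ * (c 1 : ℝ) = δ * a 1 := by rw [h]
      constructor <;> nlinarith
    · right; right
      refine ⟨?_, hcA (by simp [h]) (by simp)⟩
      rw [hai, Complex.dist_of_re_eq (by simpa using zr), Real.dist_eq, abs_lt]
      simp only [Fin.isValue, Pi.add_apply, Pi.single_eq_same, Int.cast_add, Int.cast_one]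
      have : δ * (c 1 : ℝ) = δ * a 1 + δ := by rw [h]; push_cast; ring
      constructor <;> nlinarith
  · -- both vertical
    obtain ⟨zr, zi, zi'⟩ := hz1 rfl
    obtain ⟨wr, wi, wi'⟩ := hw1 rfl
    have hc0 : c 0 = a 0 := int_eq_of_abs_mul_sub_lt hδ (by rw [← wr, ← zr, abs_sub_comm]; exact (abs_lt.2 hre).trans hηδ)
    have hc1 : c 1 = a 1 - 1 ∨ c 1 = a 1 - 1 + 1 ∨ c 1 = a 1 + 1 := by
      have k1 : δ * ((a 1 - 1 : ℤ) : ℝ) - δ < δ * c 1 := by push_cast; nlinarith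
      by_cases hlt : δ * (c 1 : ℝ) < δ * (((a 1 - 1 : ℤ) : ℝ) + 2)
      · rcases int_mem_pair_of_bounds hδ k1 hlt with h | h
        · exact Or.inl h
        · exact Or.inr (Or.inl h)
      · right; right
        push Not at hlt
        have k3 : δ * (c 1 : ℝ) < δ * ((a 1 + 1 : ℤ) + 2 : ℝ) := by push_cast at hlt ⊢; nlinarith
        have k4 : δ * ((a 1 + 1 : ℤ) : ℝ) - δ < δ * c 1 := by push_cast at hlt ⊢; nlinarith
        rcases int_mem_pair_of_bounds hδ k4 k3 with h | h
        · exact h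
        · exfalso
          have : δ * (c 1 : ℝ) = δ * (a 1 + 2) := by rw [h]; push_cast; ring
          nlinarith
    rcases hc1 with h | h | h
    · right; left
      refine ⟨?_, Or.inr ?_⟩
      · rw [ha, Complex.dist_of_re_eq (by simpa using zr), Real.dist_eq, abs_lt]
        simp only
        have : δ * (c 1 : ℝ) = δ * a 1 - δ := by rw [h]; push_cast; ring
        constructor <;> nlinarith
      · ext k; fin_cases k <;> simp [h, hc0]
    · left
      refine ⟨?_, rfl⟩
      ext k; fin_cases k <;> simp [hc0]; omega
    · right; right
      refine ⟨?_, Or.inl ?_⟩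
      · rw [hai, Complex.dist_of_re_eq (by simpa using zr), Real.dist_eq, abs_lt]
        simp only [Fin.isValue, Pi.add_apply, Pi.single_eq_same, Int.cast_add, Int.cast_one]
        have : δ * (c 1 : ℝ) = δ * a 1 + δ := by rw [h]; push_cast; ring
        constructor <;> nlinarith
      · ext k; fin_cases k <;> simp [h, hc0]

end KirchhoffSlope

end Summit.CriticalPhenomena.CardyFormulaZ2.Theorems
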